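import Summits.Ventures.YMGap.RobustBall.IndexedMember
import Summits.Ventures.YMGap.RobustBall.AxialPairTerm
import HarnessLib

/-!
# Venture YMGap, track ROBUST-BALL (tier 2) — an infinite-range gauge-invariant member of the weighted
# ball: exponentially decaying couplings of ALL axial plaquette pairs

HONEST FRAMING. WHAT THIS IS: a venture file (cell `pub-ymgap`, track Y2 ROBUST-BALL, seat rb-p1), the
NON-EMPTINESS WITNESS of the tier-2 ball beyond tier 1 (referee test T0.2 for `MemBallZdS`): the link
potential `axialPairWitness N τ κ` couples EVERY pair of parallel plaquettes `p`, `p + (n + 1) e_a` on a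
common lattice axis by `τ κ^{n+1} (Re tr U_p / N)(Re tr U_{p + (n+1) e_a} / N)` — a genuinely
infinite-range (`axialPairWitness_infiniteRange`), gauge-invariant two-plaquette interaction with
exponentially decaying coupling. We prove, from the generic `memBallZdS_indexed` (`IndexedMember.lean`) and
the index-sum bound of `AxialPairGeometry.lean`, that for `0 ≤ κ < 1`, `0 ≤ t`, `κ e^{t} < 1` it lies in
the weighted ball `MemBallZdS a Λ t` with the EXPLICIT loads
`a = 8 d (d - 1) |τ| κ / (1 - κ)`, `Λ = 16 d (d - 1) (|τ| / √N) e^{t} (κ / (1 - κ) + κ e^{t} / (1 - κ e^{t}))`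
(`memBallZdS_axialPairWitness`); the certified `SU(2)` rows are read off in `AxialPairRows.lean`.
WHAT IT IS NOT: a strong-coupling lattice statement about membership in a typed ball; no claim about the
continuum limit, asymptotic scaling, or the Clay Millennium problem.

References: the loads and the ball are those of `MassGapOnBallS.lean` (this track); counting
`|{p ∋ e}| ≤ 2(d - 1)` after Shen–Zhu–Zhu, CMP 400 (2023), §2.
-/

noncomputable section

open MeasureTheory Filter Function Topology Real Finset
open Literature.Probability.LatticeModels
open Literature.Probability.LatticeModels.DobrushinMetric
open Literature.MathematicalPhysics.QuantumLattice
open Literature.MathematicalPhysics.QuantumFieldTheory hiding ZdEdge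

namespace Summit.Ventures.YMGap.RobustBall

variable {d N : ℕ}

/-! ### The witness and its membership in the weighted ball -/

section Witness

variable (N) in
/-- **The axial-pair witness**: the link potential collecting, on each link set `X`, the axial pair terms
carried by `X` — every unordered pair of distinct parallel plaquettes on a common lattice axis, coupled by
`τ κ^{dist}` times the product of their normalised traces. -/
def axialPairWitness (τ κ : ℝ) : Potential (ZdEdge d) (Matrix.specialUnitaryGroup (Fin N) ℂ) :=
  indexedPotential axialFib (axialTerm N τ κ)

variable {τ κ t : ℝ}

/-- The incidence count `𝟙[e ∈ p] + 𝟙[e ∈ partner]` dominates `𝟙[e ∈ axialCode i]`. -/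
theorem ite_mem_axialCode_le (e : ZdEdge d) (i : AxialIdx d) {x : ℝ} (hx : 0 ≤ x) :
    (if e ∈ axialCode i then x else 0) ≤
      ((if e ∈ plaquetteEdges i.1 then (1 : ℝ) else 0) + (if e ∈ plaquetteEdges (partner i) then (1 : ℝ) else 0)) * x := by
  by_cases h : e ∈ axialCode i
  · rw [if_pos h]
    refine le_mul_of_one_le_left hx ?_
    rcases Finset.mem_union.1 h with h1 | h2
    · rw [if_pos h1]
      have : (0 : ℝ) ≤ (if e ∈ plaquetteEdges (partner i) then (1 : ℝ) else 0) := by split_ifs <;> norm_num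
      linarith
    · rw [if_pos h2]
      have : (0 : ℝ) ≤ (if e ∈ plaquetteEdges i.1 then (1 : ℝ) else 0) := by split_ifs <;> norm_num
      linarith
  · rw [if_neg h]
    exact mul_nonneg (add_nonneg (by split_ifs <;> norm_num) (by split_ifs <;> norm_num)) hx

/-- A sum of weights over the links of one plaquette is at most `4` times a common bound. -/
theorem sum_plaquetteEdges_le_four_mul {p : ZdPlaquette d} {f : ZdEdge d → ℝ} {B : ℝ} (hB : 0 ≤ B)
    (h : ∀ y ∈ plaquetteEdges p, f y ≤ B) : ∑ y ∈ plaquetteEdges p, f y ≤ 4 * B := by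
  calc ∑ y ∈ plaquetteEdges p, f y ≤ (plaquetteEdges p).card • B := Finset.sum_le_card_nsmul _ _ _ h
    _ = ((plaquetteEdges p).card : ℝ) * B := nsmul_eq_mul _ _
    _ ≤ 4 * B := mul_le_mul_of_nonneg_right (by exact_mod_cast card_plaquetteEdges_le p) hB

/-- **The weighted cross row of one term**: through a link `e` of its carrier, the term `(p, a, n)` has
`∑_{y ∈ carrier ∖ e} l(y) e^{t‖e-y‖} ≤ (4|τ|/√N) e^{t} (κ^{n+1} + (κ e^{t})^{n+1})` (`t ≥ 0`; links of the
own plaquette at distance `≤ 1`, of the other at distance `≤ n + 2`). -/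
theorem axialTerm_row_le (hN : 1 ≤ N) (hκ : 0 ≤ κ) (ht : 0 ≤ t) {e : ZdEdge d} {i : AxialIdx d}
    (he : e ∈ axialCode i) :
    ∑ y ∈ (axialCode i).erase e, |τ| * κ ^ (i.2.2 + 1) / Real.sqrt N *
        ((if y ∈ plaquetteEdges i.1 then (1 : ℝ) else 0) + (if y ∈ plaquetteEdges (partner i) then (1 : ℝ) else 0)) *
        exp (t * ‖e.1 - y.1‖) ≤
      4 * |τ| / Real.sqrt N * exp t * (κ ^ (i.2.2 + 1) + (κ * exp t) ^ (i.2.2 + 1)) := by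
  have hN0 : (0 : ℝ) < N := by exact_mod_cast hN
  have hc0 : 0 ≤ |τ| * κ ^ (i.2.2 + 1) / Real.sqrt N := by positivity
  set w : ZdEdge d → ℝ := fun y => exp (t * ‖e.1 - y.1‖) with hw
  have hw0 : ∀ y, 0 ≤ w y := fun y => (exp_pos _).le
  -- drop the erasure and split the incidence count
  have hstep1 : ∑ y ∈ (axialCode i).erase e, |τ| * κ ^ (i.2.2 + 1) / Real.sqrt N *
      ((if y ∈ plaquetteEdges i.1 then (1 : ℝ) else 0) + (if y ∈ plaquetteEdges (partner i) then (1 : ℝ) else 0)) *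
        w y ≤ ∑ y ∈ axialCode i, |τ| * κ ^ (i.2.2 + 1) / Real.sqrt N *
      ((if y ∈ plaquetteEdges i.1 then (1 : ℝ) else 0) + (if y ∈ plaquetteEdges (partner i) then (1 : ℝ) else 0)) *
        w y :=
    Finset.sum_le_sum_of_subset_of_nonneg (Finset.erase_subset _ _) fun y _ _ =>
      mul_nonneg (mul_nonneg hc0 (add_nonneg (by split_ifs <;> norm_num) (by split_ifs <;> norm_num))) (hw0 y)
  have hsplit : ∑ y ∈ axialCode i, |τ| * κ ^ (i.2.2 + 1) / Real.sqrt N *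
      ((if y ∈ plaquetteEdges i.1 then (1 : ℝ) else 0) + (if y ∈ plaquetteEdges (partner i) then (1 : ℝ) else 0)) *
        w y = |τ| * κ ^ (i.2.2 + 1) / Real.sqrt N *
      (∑ y ∈ axialCode i, (if y ∈ plaquetteEdges i.1 then w y else 0) +
        ∑ y ∈ axialCode i, (if y ∈ plaquetteEdges (partner i) then w y else 0)) := by
    rw [← Finset.sum_add_distrib, Finset.mul_sum]
    refine Finset.sum_congr rfl fun y _ => ?_
    split_ifs <;> ring
  have hP : ∑ y ∈ axialCode i, (if y ∈ plaquetteEdges i.1 then w y else 0) ≤ ∑ y ∈ plaquetteEdges i.1, w y := by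
    rw [← Finset.sum_filter]
    exact Finset.sum_le_sum_of_subset_of_nonneg (fun y hy => (Finset.mem_filter.1 hy).2) fun y _ _ => hw0 y
  have hQ : ∑ y ∈ axialCode i, (if y ∈ plaquetteEdges (partner i) then w y else 0) ≤
      ∑ y ∈ plaquetteEdges (partner i), w y := by
    rw [← Finset.sum_filter]
    exact Finset.sum_le_sum_of_subset_of_nonneg (fun y hy => (Finset.mem_filter.1 hy).2) fun y _ _ => hw0 y
  -- the two plaquette sums: one is `≤ 4 e^{t}`, the other `≤ 4 e^{t (n + 2)}`
  have hnear : ∀ {q : ZdPlaquette d}, e ∈ plaquetteEdges q → ∑ y ∈ plaquetteEdges q, w y ≤ 4 * exp t := by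
    intro q heq
    refine sum_plaquetteEdges_le_four_mul (exp_pos _).le fun y hy => ?_
    calc w y = exp (t * ‖e.1 - y.1‖) := rfl
      _ ≤ exp (t * 1) := exp_le_exp.2 (mul_le_mul_of_nonneg_left (norm_sub_le_one_of_mem_plaquetteEdges heq hy) ht)
      _ = exp t := by rw [mul_one]
  have hfarPQ : e ∈ plaquetteEdges i.1 → ∑ y ∈ plaquetteEdges (partner i), w y ≤ 4 * exp (t * ((i.2.2 : ℝ) + 2)) := by
    intro hep
    refine sum_plaquetteEdges_le_four_mul (exp_pos _).le fun y hy => ?_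
    exact exp_le_exp.2 (mul_le_mul_of_nonneg_left (norm_sub_le_of_mem_of_mem_partner hep hy) ht)
  have hfarQP : e ∈ plaquetteEdges (partner i) → ∑ y ∈ plaquetteEdges i.1, w y ≤ 4 * exp (t * ((i.2.2 : ℝ) + 2)) := by
    intro heq
    refine sum_plaquetteEdges_le_four_mul (exp_pos _).le fun y hy => ?_
    exact exp_le_exp.2 (mul_le_mul_of_nonneg_left (norm_sub_le_of_mem_partner_of_mem heq hy) ht)
  have hnear_le_far : 4 * exp t ≤ 4 * exp (t * ((i.2.2 : ℝ) + 2)) := by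
    refine mul_le_mul_of_nonneg_left (exp_le_exp.2 ?_) (by norm_num)
    nlinarith [(Nat.cast_nonneg i.2.2 : (0 : ℝ) ≤ i.2.2)]
  have htwo : ∑ y ∈ plaquetteEdges i.1, w y + ∑ y ∈ plaquetteEdges (partner i), w y ≤
      4 * exp t + 4 * exp (t * ((i.2.2 : ℝ) + 2)) := by
    rcases Finset.mem_union.1 he with h1 | h2
    · exact add_le_add (hnear h1) (hfarPQ h1)
    · calc ∑ y ∈ plaquetteEdges i.1, w y + ∑ y ∈ plaquetteEdges (partner i), w y
          ≤ 4 * exp (t * ((i.2.2 : ℝ) + 2)) + 4 * exp t := add_le_add (hfarQP h2) (hnear h2)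
        _ = 4 * exp t + 4 * exp (t * ((i.2.2 : ℝ) + 2)) := add_comm _ _
  have hexp : exp (t * ((i.2.2 : ℝ) + 2)) = exp t * (exp t) ^ (i.2.2 + 1) := by
    rw [← exp_nat_mul, ← exp_add]
    congr 1
    push_cast
    ring
  refine hstep1.trans ?_
  rw [hsplit]
  calc |τ| * κ ^ (i.2.2 + 1) / Real.sqrt N *
        (∑ y ∈ axialCode i, (if y ∈ plaquetteEdges i.1 then w y else 0) +
          ∑ y ∈ axialCode i, (if y ∈ plaquetteEdges (partner i) then w y else 0))
      ≤ |τ| * κ ^ (i.2.2 + 1) / Real.sqrt N * (4 * exp t + 4 * exp (t * ((i.2.2 : ℝ) + 2))) :=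
        mul_le_mul_of_nonneg_left ((add_le_add hP hQ).trans htwo) hc0
    _ = 4 * |τ| / Real.sqrt N * exp t * (κ ^ (i.2.2 + 1) + (κ * exp t) ^ (i.2.2 + 1)) := by
        rw [hexp, mul_pow]; ring

/-- **THE AXIAL-PAIR WITNESS IS A MEMBER OF THE WEIGHTED BALL** with explicit loads: for `0 ≤ κ < 1`,
`0 ≤ t`, `κ e^{t} < 1`,
`axialPairWitness N τ κ ∈ MemBallZdS (8 d (d-1) |τ| κ/(1-κ)) (16 d (d-1) (|τ|/√N) e^{t} (κ/(1-κ) + κe^{t}/(1-κe^{t}))) t`. -/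
theorem memBallZdS_axialPairWitness (hd : 1 ≤ d) (hN : 1 ≤ N) (hκ0 : 0 ≤ κ) (hκ1 : κ < 1) (ht : 0 ≤ t)
    (hκt : κ * exp t < 1) :
    MemBallZdS (8 * d * ((d : ℝ) - 1) * |τ| * (κ / (1 - κ)))
      (16 * d * ((d : ℝ) - 1) * (|τ| / Real.sqrt N) * exp t * (κ / (1 - κ) + κ * exp t / (1 - κ * exp t))) t
      (axialPairWitness (d := d) N τ κ) := by
  have hN0 : (0 : ℝ) < N := by exact_mod_cast hN
  have hκt0 : 0 ≤ κ * exp t := mul_nonneg hκ0 (exp_pos t).le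
  -- the four gap profiles and their sums
  have hgeoκ := tsum_pow_succ_eq hκ0 hκ1
  have hgeoκt := tsum_pow_succ_eq hκt0 hκt
  have hsκ := summable_pow_succ hκ0 hκ1
  have hsκt := summable_pow_succ hκt0 hκt
  have hind0 : ∀ (e : ZdEdge d) (i : AxialIdx d), (0 : ℝ) ≤
      (if e ∈ plaquetteEdges i.1 then (1 : ℝ) else 0) + (if e ∈ plaquetteEdges (partner i) then (1 : ℝ) else 0) :=
    fun e i => add_nonneg (by split_ifs <;> norm_num) (by split_ifs <;> norm_num)
  have hind1 : ∀ (e : ZdEdge d) (i : AxialIdx d), e ∈ axialCode i → (1 : ℝ) ≤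
      (if e ∈ plaquetteEdges i.1 then (1 : ℝ) else 0) + (if e ∈ plaquetteEdges (partner i) then (1 : ℝ) else 0) := by
    intro e i h
    rcases Finset.mem_union.1 h with h1 | h2
    · rw [if_pos h1]
      have : (0 : ℝ) ≤ (if e ∈ plaquetteEdges (partner i) then (1 : ℝ) else 0) := by split_ifs <;> norm_num
      linarith
    · rw [if_pos h2]
      have : (0 : ℝ) ≤ (if e ∈ plaquetteEdges i.1 then (1 : ℝ) else 0) := by split_ifs <;> norm_num
      linarith
  -- (M) termwise bounds `|τ| κ^{n+1}`
  have hM : ∀ e : ZdEdge d, Summable fun i : AxialIdx d => if e ∈ axialCode i then |τ| * κ ^ (i.2.2 + 1) else 0 :=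
    fun e => (summable_and_tsum_le_of_le_incidence hd (w := fun n => |τ| * κ ^ (n + 1))
      (fun n => by positivity) (hsκ.mul_left _) e
      (g := fun i => if e ∈ axialCode i then |τ| * κ ^ (i.2.2 + 1) else 0)
      (fun i => by positivity) (fun i => ite_mem_axialCode_le e i (by positivity))).1
  -- (o) oscillations `2 |τ| κ^{n+1}`
  have ho : ∀ e : ZdEdge d,
      (Summable fun i : AxialIdx d => if e ∈ axialCode i then 2 * (|τ| * κ ^ (i.2.2 + 1)) else 0) ∧
        ∑' i : AxialIdx d, (if e ∈ axialCode i then 2 * (|τ| * κ ^ (i.2.2 + 1)) else 0) ≤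
          4 * d * ((d : ℝ) - 1) * ∑' n : ℕ, 2 * (|τ| * κ ^ (n + 1)) :=
    fun e => summable_and_tsum_le_of_le_incidence hd (w := fun n => 2 * (|τ| * κ ^ (n + 1)))
      (fun n => by positivity) ((hsκ.mul_left _).mul_left _) e
      (g := fun i => if e ∈ axialCode i then 2 * (|τ| * κ ^ (i.2.2 + 1)) else 0)
      (fun i => by positivity) (fun i => ite_mem_axialCode_le e i (by positivity))
  -- (l self) self-moduli
  have hl0 : ∀ (e : ZdEdge d) (i : AxialIdx d), (0 : ℝ) ≤
      (if e ∈ axialCode i then |τ| * κ ^ (i.2.2 + 1) / Real.sqrt N *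
        ((if e ∈ plaquetteEdges i.1 then (1 : ℝ) else 0) + (if e ∈ plaquetteEdges (partner i) then (1 : ℝ) else 0))
      else 0) := by
    intro e i
    by_cases h : e ∈ axialCode i
    · rw [if_pos h]; exact mul_nonneg (by positivity) (hind0 e i)
    · rw [if_neg h]
  have hl : ∀ e : ZdEdge d, Summable fun i : AxialIdx d =>
      if e ∈ axialCode i then |τ| * κ ^ (i.2.2 + 1) / Real.sqrt N *
        ((if e ∈ plaquetteEdges i.1 then (1 : ℝ) else 0) + (if e ∈ plaquetteEdges (partner i) then (1 : ℝ) else 0))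
      else 0 := by
    intro e
    refine (summable_and_tsum_le_of_le_incidence hd (w := fun n => |τ| * κ ^ (n + 1) / Real.sqrt N)
      (fun n => by positivity) ((hsκ.mul_left _).div_const _) e (hl0 e) (fun i => ?_)).1
    by_cases h : e ∈ axialCode i
    · rw [if_pos h, mul_comm]
    · rw [if_neg h]
      exact mul_nonneg (hind0 e i) (by positivity)
  -- (row) weighted cross rows `(4|τ|/√N) e^{t} (κ^{n+1} + (κ e^{t})^{n+1})`
  have hrow0 : ∀ (e : ZdEdge d) (i : AxialIdx d), (0 : ℝ) ≤
      (if e ∈ axialCode i then ∑ y ∈ (axialCode i).erase e, |τ| * κ ^ (i.2.2 + 1) / Real.sqrt N *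
        ((if y ∈ plaquetteEdges i.1 then (1 : ℝ) else 0) + (if y ∈ plaquetteEdges (partner i) then (1 : ℝ) else 0)) *
        exp (t * ‖e.1 - y.1‖) else 0) := by
    intro e i
    by_cases h : e ∈ axialCode i
    · rw [if_pos h]
      exact Finset.sum_nonneg fun y _ => mul_nonneg (mul_nonneg (by positivity) (hind0 y i)) (exp_pos _).le
    · rw [if_neg h]
  have hrow : ∀ e : ZdEdge d,
      (Summable fun i : AxialIdx d =>
        if e ∈ axialCode i then ∑ y ∈ (axialCode i).erase e, |τ| * κ ^ (i.2.2 + 1) / Real.sqrt N *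
          ((if y ∈ plaquetteEdges i.1 then (1 : ℝ) else 0) + (if y ∈ plaquetteEdges (partner i) then (1 : ℝ) else 0)) *
          exp (t * ‖e.1 - y.1‖) else 0) ∧
      ∑' i : AxialIdx d, (if e ∈ axialCode i then ∑ y ∈ (axialCode i).erase e, |τ| * κ ^ (i.2.2 + 1) / Real.sqrt N *
          ((if y ∈ plaquetteEdges i.1 then (1 : ℝ) else 0) + (if y ∈ plaquetteEdges (partner i) then (1 : ℝ) else 0)) *
          exp (t * ‖e.1 - y.1‖) else 0) ≤
        4 * d * ((d : ℝ) - 1) * ∑' n : ℕ, 4 * |τ| / Real.sqrt N * exp t * (κ ^ (n + 1) + (κ * exp t) ^ (n + 1)) := by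
    intro e
    refine summable_and_tsum_le_of_le_incidence hd
      (w := fun n => 4 * |τ| / Real.sqrt N * exp t * (κ ^ (n + 1) + (κ * exp t) ^ (n + 1)))
      (fun n => by positivity) ((hsκ.add hsκt).mul_left _) e (hrow0 e) (fun i => ?_)
    by_cases h : e ∈ axialCode i
    · rw [if_pos h]
      refine (axialTerm_row_le hN hκ0 ht h).trans ?_
      have hw0 : 0 ≤ 4 * |τ| / Real.sqrt N * exp t * (κ ^ (i.2.2 + 1) + (κ * exp t) ^ (i.2.2 + 1)) := by
        positivity
      exact le_mul_of_one_le_left hw0 (hind1 e i h)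
    · rw [if_neg h]
      exact mul_nonneg (hind0 e i) (by positivity)
  -- assemble
  have hmem := memBallZdS_indexed (code := axialCode) (fib := axialFib) (φ := axialTerm N τ κ) mem_axialFib
    continuous_axialTerm dependsOn_axialTerm (M := fun i => |τ| * κ ^ (i.2.2 + 1)) (abs_axialTerm_le hN hκ0)
    hM (isOscBound_axialTerm hN hκ0) (isLipBound_axialTerm hN hκ0) (t := t)
    (fun e => (ho e).1) (fun e => (ho e).2) hl (fun e => (hrow e).1) (fun e => (hrow e).2)
  -- rewrite the two load expressions
  have ha : 4 * d * ((d : ℝ) - 1) * ∑' n : ℕ, 2 * (|τ| * κ ^ (n + 1)) = 8 * d * ((d : ℝ) - 1) * |τ| * (κ / (1 - κ)) := by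
    rw [tsum_mul_left, tsum_mul_left, hgeoκ]; ring
  have hΛ : 4 * d * ((d : ℝ) - 1) * ∑' n : ℕ, 4 * |τ| / Real.sqrt N * exp t * (κ ^ (n + 1) + (κ * exp t) ^ (n + 1)) =
      16 * d * ((d : ℝ) - 1) * (|τ| / Real.sqrt N) * exp t * (κ / (1 - κ) + κ * exp t / (1 - κ * exp t)) := by
    rw [tsum_mul_left, hsκ.tsum_add hsκt, hgeoκ, hgeoκt]; ring
  rw [ha, hΛ] at hmem
  exact hmem

/-- **Infinite range, quantitatively**: at the trivial configuration the witness term on the carrier of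
`(p, a, n)` is at least its coupling `τ κ^{n+1} > 0` (all terms carried there are nonnegative at `U ≡ 1`),
while that carrier contains two links at distance `≥ n + 1` (`le_norm_fst_sub_partner_fst`). -/
theorem le_axialPairWitness_code_one (hN : 1 ≤ N) (hτ : 0 ≤ τ) (hκ : 0 ≤ κ) (i : AxialIdx d) :
    τ * κ ^ (i.2.2 + 1) ≤
      axialPairWitness N τ κ (axialCode i) (1 : LGConfig d (Matrix.specialUnitaryGroup (Fin N) ℂ)) := by
  unfold axialPairWitness
  rw [indexedPotential_apply]
  simp_rw [axialTerm_one hN]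
  exact Finset.single_le_sum (f := fun j : AxialIdx d => τ * κ ^ (j.2.2 + 1)) (fun j _ => by positivity)
    ((mem_axialFib _ _).2 rfl)

/-- **The witness has infinite range**: for every `R` there is a link set carrying a NONZERO term of
`axialPairWitness N τ κ` (`τ, κ > 0`, `d ≥ 2`) and containing two links at `ℓ^∞`-distance `> R` — the
member is not of finite range, so it lies outside the reach of the tier-1 balls `MemBallZd ε₀ ε₁ R`. -/
theorem axialPairWitness_infiniteRange (hd : 2 ≤ d) (hN : 1 ≤ N) (hτ : 0 < τ) (hκ : 0 < κ) (R : ℝ) :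
    ∃ (X : Finset (ZdEdge d)) (e y : ZdEdge d), e ∈ X ∧ y ∈ X ∧ R < ‖e.1 - y.1‖ ∧
      axialPairWitness (d := d) N τ κ X ≠ 0 := by
  set a : Fin d := ⟨0, by omega⟩ with ha
  set b : Fin d := ⟨1, by omega⟩ with hb
  have hab : a < b := by simp [ha, hb, Fin.lt_def]
  set p : ZdPlaquette d := ((0 : Site d), ⟨(a, b), hab⟩) with hp
  set i : AxialIdx d := (p, a, ⌈R⌉₊) with hi
  refine ⟨axialCode i, (i.1.1, i.1.2.1.1), (i.1.1 + axialShift i.2.1 i.2.2, i.1.2.1.1), fst_mem_axialCode i,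
    partner_fst_mem_axialCode i, ?_, fun h0 => ?_⟩
  · calc R ≤ ⌈R⌉₊ := Nat.le_ceil R
      _ < (⌈R⌉₊ : ℝ) + 1 := lt_add_one _
      _ = (i.2.2 : ℝ) + 1 := by simp [hi]
      _ ≤ _ := le_norm_fst_sub_partner_fst i
  · have h1 := le_axialPairWitness_code_one hN hτ.le hκ.le i
    rw [h0] at h1
    exact absurd h1 (not_le.2 (by positivity))

/-- **The witness lies in NO tier-1 ball**: for `τ, κ > 0` and `d ≥ 2`, `axialPairWitness N τ κ` is not a
member of `MemBallZd ε₀ ε₁ R W supp` for any radii, range `R` and support family (a listed active carrier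
through a link would have to stay within distance `R` of it; `axialPairWitness_infiniteRange`). -/
theorem not_memBallZd_axialPairWitness (hd : 2 ≤ d) (hN : 1 ≤ N) (hτ : 0 < τ) (hκ : 0 < κ) (ε₀ ε₁ R : ℝ)
    (supp : Finset (ZdEdge d) → Finset (Finset (ZdEdge d))) :
    ¬ MemBallZd ε₀ ε₁ R (axialPairWitness (d := d) N τ κ) supp := by
  intro hW
  obtain ⟨X, e, y, he, hy, hR, hne⟩ := axialPairWitness_infiniteRange hd hN hτ hκ R
  have hX : X ∈ supp {e} := hW.supportedBy {e} X ⟨e, Finset.mem_inter.2 ⟨he, Finset.mem_singleton_self e⟩⟩ hne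
  exact absurd (hW.range e X hX he y hy) (not_le.2 hR)

end Witness

end Summit.Ventures.YMGap.RobustBall
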